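import Literature.Topology.FourManifolds.FishtailZoneMid
import HarnessLib

/-!
# The tube about Gompf's disc near the south cap: rescaling and the frame switch

Infrastructure for the explicit fishtail neighbourhood (R. Gompf, *More Cappell–Shaneson spheres
are standard*, Algebr. Geom. Topol. 10 (2010), proof of Thm 2.1 (`F′`, `D`) and Lemma 2.2; the
named fact `Literature.Topology.FourManifolds.gompf2010_framedTwist`). Near the centre of Gompf's
disc `D` (the south cap point of the surgered section sphere) the tube has to be written in the
product chart of the surgery piece, which physically is the *sphere form*
`n₀ (√(1 - κ²(a² + b²)), κ a, -κ b)` (offsets along the sphere of radius `n₀`, of size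
proportional to `n₀`); further out the disc is the graph over the `(n, s)`-annulus with the
*vertical* (`n`-fixed) tube `(n₀ + κ b, κ a, -κ b)` of constant scale (`FishtailZoneMid.lean`).
This file provides the two transitions, in real coordinates `(n₀, s, a, b) ↦ ((x, y, z), s)`:

* `Literature.Topology.FourManifolds.scaleReal κ` — **the rescaling**
  `(√(n₀² - κ(n₀)²(a²+b²)), κ(n₀) a, -κ(n₀) b)` with a smooth positive scale `κ(n₀)` (from the cone
  `c n₀` to a constant): a local diffeomorphism (two graphs: the linear scaling of the offsets, and
  `n₀ ↦ √(n₀² - A² - B²)`), `isLocalDiffeomorphAt_scaleReal`; the sphere radius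
  `‖(x, y, z)‖ = n₀` is preserved (`norm_scaleReal`), which gives injectivity (`scaleReal_inj`);
* `Literature.Topology.FourManifolds.switchXReal μ κ` — **the frame switch**
  `x = (1 - μ(n₀)) √(n₀² - κ²(a²+b²)) + μ(n₀) (n₀ + κ b)`, `(y, z) = (κ a, -κ b)`: its
  `n₀`-derivative is bounded below by `1/2` for small offsets (`half_le_deriv_switchX`), so it is
  a local diffeomorphism (`isLocalDiffeomorphAt_switchXReal`, parametric inverse function
  theorem in one unknown) and injective (`switchXReal_inj`, strict monotonicity in `n₀`); at
  `μ = 0` it is the rescaling with constant scale, at `μ = 1` the vertical tube of the flat annulus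
  (`switchXReal_of_mu_zero`, `switchXReal_of_mu_one`).
* Both read in the mapping torus through `mtCoord` (`isLocalDiffeomorphAt_mtCoord_scaleReal`,
  `isLocalDiffeomorphAt_mtCoord_switchXReal`).

* `scaleRealN`, `switchXRealN` — the mirrored pieces at the north cap (axis `{(e^{in},1,1)}`,
  `n < 0`), obtained through the involution `mirrorL (x, y, z) = (-x, y, -z)` after `b ↦ -b`.

Everything is proved; no named facts.

## References

* R. E. Gompf, *More Cappell–Shaneson spheres are standard*, Algebr. Geom. Topol. 10 (2010)
  1665–1681, proof of Thm 2.1 and Lemma 2.2. [GompfAGT2010]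
-/

noncomputable section

open scoped Real ContDiff Topology Manifold
open Set Function Filter

namespace Literature.Topology.FourManifolds

local notation "𝔼" n => EuclideanSpace ℝ (Fin n)
local notation "𝓣" =>
  (ModelWithCorners.prod (𝓡 1) (ModelWithCorners.prod (𝓡 1) (𝓡 1)))

/-! ### Reorderings -/

section Reorder

/-- The reordering `((n₀, s), (A, B)) ↦ ((s, A, B), n₀)`, a diffeomorphism. [folklore] -/
def southMid : ((ℝ × ℝ) × (ℝ × ℝ)) ≃ₘ⟮𝓘(ℝ, (ℝ × ℝ) × (ℝ × ℝ)), 𝓘(ℝ, (ℝ × ℝ × ℝ) × ℝ)⟯ ((ℝ × ℝ × ℝ) × ℝ) where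
  toFun p := ((p.1.2, p.2.1, p.2.2), p.1.1)
  invFun r := ((r.2, r.1.1), (r.1.2.1, r.1.2.2))
  left_inv p := by simp
  right_inv r := by simp
  contMDiff_toFun := by
    refine contMDiff_iff_contDiff.2 ?_
    have h1 : ContDiff ℝ ∞ fun p : (ℝ × ℝ) × (ℝ × ℝ) ↦ p.1.1 := contDiff_fst.comp contDiff_fst
    have h2 : ContDiff ℝ ∞ fun p : (ℝ × ℝ) × (ℝ × ℝ) ↦ p.1.2 := contDiff_snd.comp contDiff_fst
    have h3 : ContDiff ℝ ∞ fun p : (ℝ × ℝ) × (ℝ × ℝ) ↦ p.2.1 := contDiff_fst.comp contDiff_snd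
    have h4 : ContDiff ℝ ∞ fun p : (ℝ × ℝ) × (ℝ × ℝ) ↦ p.2.2 := contDiff_snd.comp contDiff_snd
    exact (h2.prodMk (h3.prodMk h4)).prodMk h1
  contMDiff_invFun := by
    refine contMDiff_iff_contDiff.2 ?_
    have h1 : ContDiff ℝ ∞ fun r : (ℝ × ℝ × ℝ) × ℝ ↦ r.1.1 := contDiff_fst.comp contDiff_fst
    have h2 : ContDiff ℝ ∞ fun r : (ℝ × ℝ × ℝ) × ℝ ↦ r.1.2.1 := contDiff_fst.comp (contDiff_snd.comp contDiff_fst)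
    have h3 : ContDiff ℝ ∞ fun r : (ℝ × ℝ × ℝ) × ℝ ↦ r.1.2.2 := contDiff_snd.comp (contDiff_snd.comp contDiff_fst)
    have h4 : ContDiff ℝ ∞ fun r : (ℝ × ℝ × ℝ) × ℝ ↦ r.2 := contDiff_snd
    exact (h4.prodMk h1).prodMk (h2.prodMk h3)

/-- The value of `southMid`. [folklore] -/
@[simp] theorem southMid_apply (p : (ℝ × ℝ) × (ℝ × ℝ)) : southMid p = ((p.1.2, p.2.1, p.2.2), p.1.1) := rfl

/-- The assembly `((s, A, B), X) ↦ ((X, A, -B), s)`, a diffeomorphism onto `𝔼³ × ℝ`. [folklore] -/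
def southOut : ((ℝ × ℝ × ℝ) × ℝ) ≃ₘ⟮𝓘(ℝ, (ℝ × ℝ × ℝ) × ℝ), 𝓘(ℝ, (𝔼 3) × ℝ)⟯ ((𝔼 3) × ℝ) where
  toFun r := (WithLp.toLp 2 ![r.2, r.1.2.1, -r.1.2.2], r.1.1)
  invFun q := ((q.2, q.1 1, -q.1 2), q.1 0)
  left_inv r := by
    obtain ⟨⟨s, A, B⟩, X⟩ := r
    simp
  right_inv q := by
    obtain ⟨v, s⟩ := q
    refine Prod.ext ?_ rfl
    ext j
    fin_cases j <;> simp
  contMDiff_toFun := by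
    refine contMDiff_iff_contDiff.2 ?_
    refine ContDiff.prodMk ?_ (contDiff_fst.comp contDiff_fst)
    rw [contDiff_piLp]
    intro j
    fin_cases j
    · exact contDiff_snd
    · exact contDiff_fst.comp (contDiff_snd.comp contDiff_fst)
    · exact (contDiff_snd.comp (contDiff_snd.comp contDiff_fst)).neg
  contMDiff_invFun := by
    refine contMDiff_iff_contDiff.2 ?_
    have hc : ∀ j : Fin 3, ContDiff ℝ ∞ fun q : (𝔼 3) × ℝ ↦ q.1 j := fun j ↦
      (contDiff_piLp_apply (p := 2) (i := j)).comp contDiff_fst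
    exact (contDiff_snd.prodMk ((hc 1).prodMk (hc 2).neg)).prodMk (hc 0)

/-- The value of `southOut`. [folklore] -/
@[simp] theorem southOut_apply (r : (ℝ × ℝ × ℝ) × ℝ) :
    southOut r = (WithLp.toLp 2 ![r.2, r.1.2.1, -r.1.2.2], r.1.1) := rfl

end Reorder

/-! ### The rescaling -/

section Scale

variable (kap : ℝ → ℝ)

/-- The sphere abscissa `√(n₀² - A² - B²)`. [folklore] -/
def sphX (n₀ A B : ℝ) : ℝ := Real.sqrt (n₀ ^ 2 - A ^ 2 - B ^ 2)

/-- **The rescaling in real form**: `(n₀, s, a, b) ↦ ((√(n₀² - κ² (a² + b²)), κ a, -κ b), s)`,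
`κ = κ(n₀)`. [folklore] -/
def scaleReal (q : ℝ × ℝ × ℝ × ℝ) : (𝔼 3) × ℝ :=
  (WithLp.toLp 2 ![sphX q.1 (kap q.1 * q.2.2.1) (kap q.1 * q.2.2.2), kap q.1 * q.2.2.1, -(kap q.1 * q.2.2.2)], q.2.1)

variable {kap}

/-- **The sphere radius is preserved**: `‖(scaleReal q).1‖ = n₀` when `n₀ ≥ 0` and the offsets
are admissible. [folklore] -/
theorem norm_scaleReal {q : ℝ × ℝ × ℝ × ℝ} (hn : 0 ≤ q.1)
    (h : (kap q.1 * q.2.2.1) ^ 2 + (kap q.1 * q.2.2.2) ^ 2 ≤ q.1 ^ 2) : ‖(scaleReal kap q).1‖ = q.1 := by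
  rw [scaleReal, EuclideanSpace.norm_eq]
  simp only [Fin.sum_univ_three, Matrix.cons_val_zero, Matrix.cons_val_one,
    Matrix.cons_val, Real.norm_eq_abs, sq_abs]
  rw [sphX, Real.sq_sqrt (by linarith), neg_sq]
  rw [show q.1 ^ 2 - (kap q.1 * q.2.2.1) ^ 2 - (kap q.1 * q.2.2.2) ^ 2 + (kap q.1 * q.2.2.1) ^ 2 +
    (kap q.1 * q.2.2.2) ^ 2 = q.1 ^ 2 by ring]
  exact Real.sqrt_sq hn

/-- **Injectivity of the rescaling**: for `n₀, n₀' > 0`, `κ(n₀) ≠ 0` and admissible offsets. [folklore] -/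
theorem scaleReal_inj {q q' : ℝ × ℝ × ℝ × ℝ} (hn : 0 < q.1) (hn' : 0 < q'.1) (hk : ∀ n, 0 < n → kap n ≠ 0)
    (h : (kap q.1 * q.2.2.1) ^ 2 + (kap q.1 * q.2.2.2) ^ 2 ≤ q.1 ^ 2)
    (h' : (kap q'.1 * q'.2.2.1) ^ 2 + (kap q'.1 * q'.2.2.2) ^ 2 ≤ q'.1 ^ 2)
    (heq : scaleReal kap q = scaleReal kap q') : q = q' := by
  have hnn : q.1 = q'.1 := by
    rw [← norm_scaleReal hn.le h, ← norm_scaleReal hn'.le h', heq]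
  have h1 := congrArg (fun r : (𝔼 3) × ℝ ↦ r.1 1) heq
  have h2 := congrArg (fun r : (𝔼 3) × ℝ ↦ r.1 2) heq
  have hs := congrArg Prod.snd heq
  simp only [scaleReal, PiLp.toLp_apply, Matrix.cons_val_one, Matrix.cons_val, Matrix.cons_val_zero] at h1 h2 hs
  rw [← hnn] at h1 h2
  have hk0 := hk q.1 hn
  have ha : q.2.2.1 = q'.2.2.1 := mul_left_cancel₀ hk0 h1
  have hb : q.2.2.2 = q'.2.2.2 := mul_left_cancel₀ hk0 (neg_inj.1 h2)
  exact Prod.ext hnn (Prod.ext hs (Prod.ext ha hb))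

/-- The rescaling factors: `scaleReal = southOut ∘ (graph of √) ∘ southMid ∘ (graph of the scaling) ∘ midIn`. [folklore] -/
theorem scaleReal_eq (q : ℝ × ℝ × ℝ × ℝ) :
    scaleReal kap q = southOut
      ((southMid ((midIn q).1, (kap (midIn q).1.1 * (midIn q).2.1, kap (midIn q).1.1 * (midIn q).2.2))).1,
        sphX (southMid ((midIn q).1, (kap (midIn q).1.1 * (midIn q).2.1, kap (midIn q).1.1 * (midIn q).2.2))).2
          (southMid ((midIn q).1, (kap (midIn q).1.1 * (midIn q).2.1, kap (midIn q).1.1 * (midIn q).2.2))).1.2.1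
          (southMid ((midIn q).1, (kap (midIn q).1.1 * (midIn q).2.1, kap (midIn q).1.1 * (midIn q).2.2))).1.2.2) := by
  simp only [scaleReal, southOut_apply, southMid_apply, midIn_apply]

/-- The partial derivative of the sphere abscissa: `∂ √(n₀² - A² - B²)/∂n₀ = n₀/√`. [folklore] -/
theorem hasDerivAt_sphX {n₀ A B : ℝ} (h : A ^ 2 + B ^ 2 < n₀ ^ 2) :
    HasDerivAt (fun n ↦ sphX n A B) (n₀ / Real.sqrt (n₀ ^ 2 - A ^ 2 - B ^ 2)) n₀ := by
  unfold sphX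
  have hpos : 0 < n₀ ^ 2 - A ^ 2 - B ^ 2 := by linarith
  have h1 : HasDerivAt (fun n : ℝ ↦ n ^ 2 - A ^ 2 - B ^ 2) (2 * n₀) n₀ := by
    simpa using ((hasDerivAt_pow 2 n₀).sub_const (A ^ 2)).sub_const (B ^ 2)
  have h2 := h1.sqrt hpos.ne'
  refine h2.congr_deriv ?_
  field_simp

/-- **The rescaling is a local diffeomorphism** where `n₀ > 0`, `κ(n₀) ≠ 0`, `κ` is smooth and the
offsets are strictly admissible. [folklore] -/
theorem isLocalDiffeomorphAt_scaleReal (hkap : ContDiff ℝ ∞ kap) {q : ℝ × ℝ × ℝ × ℝ} (hn : 0 < q.1)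
    (hk : kap q.1 ≠ 0) (h : (kap q.1 * q.2.2.1) ^ 2 + (kap q.1 * q.2.2.2) ^ 2 < q.1 ^ 2) :
    IsLocalDiffeomorphAt 𝓘(ℝ, ℝ × ℝ × ℝ × ℝ) 𝓘(ℝ, (𝔼 3) × ℝ) ∞ (scaleReal kap) q := by
  -- (1) reorder
  have h1 : IsLocalDiffeomorphAt 𝓘(ℝ, ℝ × ℝ × ℝ × ℝ) 𝓘(ℝ, (ℝ × ℝ) × (ℝ × ℝ)) ∞ midIn q := midIn.isLocalDiffeomorph q
  -- (2) the scaling of the offsets (graph over `(n₀, s)`)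
  have h2 : IsLocalDiffeomorphAt 𝓘(ℝ, (ℝ × ℝ) × (ℝ × ℝ)) 𝓘(ℝ, (ℝ × ℝ) × (ℝ × ℝ)) ∞
      (fun p : (ℝ × ℝ) × (ℝ × ℝ) ↦ (p.1, (kap p.1.1 * p.2.1, kap p.1.1 * p.2.2))) (midIn q) := by
    have hf : ContDiff ℝ ∞ fun p : (ℝ × ℝ) × (ℝ × ℝ) ↦ (kap p.1.1 * p.2.1, kap p.1.1 * p.2.2) := by
      have hk' : ContDiff ℝ ∞ fun p : (ℝ × ℝ) × (ℝ × ℝ) ↦ kap p.1.1 := hkap.comp (contDiff_fst.comp contDiff_fst)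
      exact (hk'.mul (contDiff_fst.comp contDiff_snd)).prodMk (hk'.mul (contDiff_snd.comp contDiff_snd))
    refine isLocalDiffeomorphAt_graph' hf (by exact_mod_cast le_top)
      (pair2EquivProd (kap q.1, 0) (0, kap q.1) (by simpa using hk)) ?_
    have hu1 : HasDerivAt (fun a : ℝ ↦ kap q.1 * a) (kap q.1) (midIn q).2.1 := by
      simpa using (hasDerivAt_id (midIn q).2.1).const_mul (kap q.1)
    have hv1 : HasDerivAt (fun b : ℝ ↦ kap q.1 * b) (kap q.1) (midIn q).2.2 := by
      simpa using (hasDerivAt_id (midIn q).2.2).const_mul (kap q.1)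
    have hu : HasDerivAt (fun a ↦ (kap q.1 * a, kap q.1 * (midIn q).2.2)) (kap q.1, 0) (midIn q).2.1 :=
      hu1.prodMk (hasDerivAt_const _ _)
    have hv : HasDerivAt (fun b ↦ (kap q.1 * (midIn q).2.1, kap q.1 * b)) (0, kap q.1) (midIn q).2.2 :=
      (hasDerivAt_const _ _).prodMk hv1
    have hdiff : DifferentiableAt ℝ (fun x : ℝ × ℝ ↦ (kap q.1 * x.1, kap q.1 * x.2)) (midIn q).2 :=
      ((differentiableAt_const _).mul differentiableAt_fst).prodMk ((differentiableAt_const _).mul differentiableAt_snd)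
    have hd := hasFDerivAt_of_partials hdiff hu hv
    rw [coe_pair2EquivProd]
    exact hd
  set p₂ : (ℝ × ℝ) × (ℝ × ℝ) := ((midIn q).1, (kap q.1 * (midIn q).2.1, kap q.1 * (midIn q).2.2)) with hp₂
  -- (3) reorder
  have h3 : IsLocalDiffeomorphAt 𝓘(ℝ, (ℝ × ℝ) × (ℝ × ℝ)) 𝓘(ℝ, (ℝ × ℝ × ℝ) × ℝ) ∞ southMid p₂ := southMid.isLocalDiffeomorph p₂
  -- (4) the square root (graph over `(s, A, B)`, unknown `n₀`)
  have hAB : (southMid p₂).1.2.1 ^ 2 + (southMid p₂).1.2.2 ^ 2 < (southMid p₂).2 ^ 2 := by simpa [hp₂] using h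
  have h4 : IsLocalDiffeomorphAt 𝓘(ℝ, (ℝ × ℝ × ℝ) × ℝ) 𝓘(ℝ, (ℝ × ℝ × ℝ) × ℝ) ∞
      (fun r : (ℝ × ℝ × ℝ) × ℝ ↦ (r.1, sphX r.2 r.1.2.1 r.1.2.2)) (southMid p₂) := by
    set U : Set ((ℝ × ℝ × ℝ) × ℝ) := {r | r.1.2.1 ^ 2 + r.1.2.2 ^ 2 < r.2 ^ 2 ∧ 0 < r.2} with hU
    have hUo : IsOpen U := by
      rw [hU]
      exact (isOpen_lt (((continuous_fst.comp (continuous_snd.comp continuous_fst)).pow 2).add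
        ((continuous_snd.comp (continuous_snd.comp continuous_fst)).pow 2)) (continuous_snd.pow 2)).inter
        (isOpen_lt continuous_const continuous_snd)
    have hmem : southMid p₂ ∈ U := ⟨hAB, by simpa [hp₂] using hn⟩
    have hf : ContDiffOn ℝ ∞ (fun r : (ℝ × ℝ × ℝ) × ℝ ↦ sphX r.2 r.1.2.1 r.1.2.2) U := by
      intro r hr
      refine ContDiffAt.contDiffWithinAt ?_
      unfold sphX
      refine ContDiffAt.sqrt ?_ (show r.2 ^ 2 - r.1.2.1 ^ 2 - r.1.2.2 ^ 2 ≠ 0 by nlinarith [hr.1])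
      exact ((contDiffAt_snd.pow 2).sub ((contDiffAt_fst.comp r (contDiffAt_snd.comp r contDiffAt_fst)).pow 2)).sub
        ((contDiffAt_snd.comp r (contDiffAt_snd.comp r contDiffAt_fst)).pow 2)
    have hder := hasDerivAt_sphX (n₀ := (southMid p₂).2) (A := (southMid p₂).1.2.1) (B := (southMid p₂).1.2.2) hAB
    have hne : (southMid p₂).2 / Real.sqrt ((southMid p₂).2 ^ 2 - (southMid p₂).1.2.1 ^ 2 - (southMid p₂).1.2.2 ^ 2) ≠ 0 := by
      have hn' : 0 < (southMid p₂).2 := by simpa [hp₂] using hn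
      exact div_ne_zero hn'.ne' (Real.sqrt_pos.2 (by linarith)).ne'
    exact isLocalDiffeomorphAt_graph_real hUo hmem hf (by exact_mod_cast le_top) hne hder
  -- (5) assemble
  have h5 := southOut.isLocalDiffeomorph ((southMid p₂).1, sphX (southMid p₂).2 (southMid p₂).1.2.1 (southMid p₂).1.2.2)
  have h := (((h1.comp (K := 𝓘(ℝ, (ℝ × ℝ) × (ℝ × ℝ))) (P := (ℝ × ℝ) × (ℝ × ℝ)) h2).comp
    (K := 𝓘(ℝ, (ℝ × ℝ × ℝ) × ℝ)) (P := (ℝ × ℝ × ℝ) × ℝ) h3).comp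
    (K := 𝓘(ℝ, (ℝ × ℝ × ℝ) × ℝ)) (P := (ℝ × ℝ × ℝ) × ℝ) h4).comp
    (K := 𝓘(ℝ, (𝔼 3) × ℝ)) (P := (𝔼 3) × ℝ) h5
  exact isLocalDiffeomorphAt_congr_nhds' h (Eventually.of_forall fun q' ↦ scaleReal_eq q')

variable (ψ : ThreeTorus ≃ₘ⟮𝓣, 𝓣⟯ ThreeTorus)

/-- **The rescaling, read in the mapping torus, is a local diffeomorphism** (`0 < s < 3/2`). [folklore] -/
theorem isLocalDiffeomorphAt_mtCoord_scaleReal (hkap : ContDiff ℝ ∞ kap) {q : ℝ × ℝ × ℝ × ℝ} (hn : 0 < q.1)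
    (hk : kap q.1 ≠ 0) (h : (kap q.1 * q.2.2.1) ^ 2 + (kap q.1 * q.2.2.2) ^ 2 < q.1 ^ 2)
    (h0 : 0 < q.2.1) (h1 : q.2.1 < 3 / 2) :
    IsLocalDiffeomorphAt 𝓘(ℝ, ℝ × ℝ × ℝ × ℝ) 𝓘(ℝ, 𝔼 4) ∞ (fun q ↦ mtCoord ψ (scaleReal kap q)) q := by
  have hR := isLocalDiffeomorphAt_scaleReal hkap hn hk h
  have hC : IsLocalDiffeomorphAt 𝓘(ℝ, (𝔼 3) × ℝ) 𝓘(ℝ, 𝔼 4) ∞ (mtCoord ψ) (scaleReal kap q) := by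
    have h := isLocalDiffeomorphAt_mtCoord (ψ := ψ) (q := scaleReal kap q) h0 h1
    rw [← modelWithCornersSelf_prod, chartedSpaceSelf_prod] at h
    exact h
  exact hR.comp (K := 𝓘(ℝ, 𝔼 4)) (P := MTorus ψ) hC

end Scale

/-! ### The frame switch -/

section Switch

variable (μ : ℝ → ℝ) (kap : ℝ)

/-- The abscissa of the switch: `X = (1 - μ(n₀)) √(n₀² - κ²(a² + b²)) + μ(n₀) (n₀ + κ b)`. [folklore] -/
def switchX (n₀ a b : ℝ) : ℝ := (1 - μ n₀) * sphX n₀ (kap * a) (kap * b) + μ n₀ * (n₀ + kap * b)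

/-- **The frame switch in real form**: `(n₀, s, a, b) ↦ ((X, κ a, -κ b), s)`. [folklore] -/
def switchXReal (q : ℝ × ℝ × ℝ × ℝ) : (𝔼 3) × ℝ :=
  (WithLp.toLp 2 ![switchX μ kap q.1 q.2.2.1 q.2.2.2, kap * q.2.2.1, -(kap * q.2.2.2)], q.2.1)

variable {μ kap}

/-- At `μ = 0` the switch is the rescaling with constant scale. [folklore] -/
theorem switchXReal_of_mu_zero {q : ℝ × ℝ × ℝ × ℝ} (h : μ q.1 = 0) :
    switchXReal μ kap q = scaleReal (fun _ ↦ kap) q := by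
  simp only [switchXReal, switchX, h, scaleReal]
  simp

/-- At `μ = 1` the switch is the vertical tube of the flat annulus `(n₀ + κ b, κ a, -κ b)`. [folklore] -/
theorem switchXReal_of_mu_one {q : ℝ × ℝ × ℝ × ℝ} (h : μ q.1 = 1) :
    switchXReal μ kap q = (WithLp.toLp 2 ![q.1 + kap * q.2.2.2, kap * q.2.2.1, -(kap * q.2.2.2)], q.2.1) := by
  simp only [switchXReal, switchX, h]
  simp

/-- **The `n₀`-derivative of the switch abscissa.** [folklore] -/
theorem hasDerivAt_switchX (hμ : ContDiff ℝ ∞ μ) {n₀ a b : ℝ} (h : (kap * a) ^ 2 + (kap * b) ^ 2 < n₀ ^ 2) :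
    HasDerivAt (fun n ↦ switchX μ kap n a b)
      (-deriv μ n₀ * sphX n₀ (kap * a) (kap * b) +
        (1 - μ n₀) * (n₀ / Real.sqrt (n₀ ^ 2 - (kap * a) ^ 2 - (kap * b) ^ 2)) +
        (deriv μ n₀ * (n₀ + kap * b) + μ n₀ * 1)) n₀ := by
  have hμ' : HasDerivAt μ (deriv μ n₀) n₀ := ((hμ.differentiable (by simp)) n₀).hasDerivAt
  have hs := hasDerivAt_sphX h
  unfold switchX
  have h1 : HasDerivAt (fun n ↦ (1 - μ n) * sphX n (kap * a) (kap * b))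
      ((0 - deriv μ n₀) * sphX n₀ (kap * a) (kap * b) +
        (1 - μ n₀) * (n₀ / Real.sqrt (n₀ ^ 2 - (kap * a) ^ 2 - (kap * b) ^ 2))) n₀ :=
    ((hasDerivAt_const n₀ 1).sub hμ').mul hs
  have h2 : HasDerivAt (fun n ↦ μ n * (n + kap * b)) (deriv μ n₀ * (n₀ + kap * b) + μ n₀ * 1) n₀ :=
    hμ'.mul ((hasDerivAt_id n₀).add_const (kap * b))
  exact (h1.add h2).congr_deriv (by ring)

/-- **The `n₀`-derivative of the switch abscissa is at least `1/2`** when `0 ≤ μ ≤ 1`,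
`|μ′| ≤ M`, `0 < n₀`, the offsets satisfy `κ²(a² + b²) ≤ n₀²/4` and
`M (|κ b| + 2 κ²(a² + b²)/n₀) ≤ 1/2`. [folklore] -/
theorem half_le_deriv_switchX {M n₀ a b : ℝ} (hμ1 : μ n₀ ≤ 1) (hM : |deriv μ n₀| ≤ M)
    (hn : 0 < n₀) (hq : (kap * a) ^ 2 + (kap * b) ^ 2 ≤ n₀ ^ 2 / 4)
    (hsmall : M * (|kap * b| + 2 * ((kap * a) ^ 2 + (kap * b) ^ 2) / n₀) ≤ 1 / 2) :
    1 / 2 ≤ -deriv μ n₀ * sphX n₀ (kap * a) (kap * b) +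
        (1 - μ n₀) * (n₀ / Real.sqrt (n₀ ^ 2 - (kap * a) ^ 2 - (kap * b) ^ 2)) +
        (deriv μ n₀ * (n₀ + kap * b) + μ n₀ * 1) := by
  set Q := (kap * a) ^ 2 + (kap * b) ^ 2 with hQ
  set S := Real.sqrt (n₀ ^ 2 - (kap * a) ^ 2 - (kap * b) ^ 2) with hS
  have hQ0 : 0 ≤ Q := by positivity
  have hin : 0 < n₀ ^ 2 - (kap * a) ^ 2 - (kap * b) ^ 2 := by nlinarith
  have hSpos : 0 < S := Real.sqrt_pos.2 hin
  have hSle : S ≤ n₀ := by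
    rw [hS, Real.sqrt_le_left hn.le]
    nlinarith
  have hSge : n₀ / 2 ≤ S := by
    rw [hS, Real.le_sqrt (by linarith) hin.le]
    nlinarith
  -- `n₀ - S ≤ 2 Q / n₀`
  have hgap : n₀ - S ≤ 2 * Q / n₀ := by
    have hsq : S ^ 2 = n₀ ^ 2 - Q := by rw [hS, Real.sq_sqrt hin.le, hQ]; ring
    have : (n₀ - S) * (n₀ + S) = Q := by nlinarith
    rw [le_div_iff₀ hn]
    nlinarith
  have hsph : sphX n₀ (kap * a) (kap * b) = S := rfl
  rw [hsph]
  -- the main terms: `(1 - μ) n₀/S + μ ≥ 1`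
  have hmain : 1 ≤ (1 - μ n₀) * (n₀ / S) + μ n₀ := by
    have : 1 ≤ n₀ / S := by rw [le_div_iff₀ hSpos]; linarith
    nlinarith
  -- the perturbation: `|μ′| (n₀ + κ b - S) ≤ M (|κ b| + 2Q/n₀) ≤ 1/2`
  have hpert : |deriv μ n₀ * (n₀ + kap * b - S)| ≤ 1 / 2 := by
    rw [abs_mul]
    have h1 : |n₀ + kap * b - S| ≤ |kap * b| + 2 * Q / n₀ := by
      have := abs_add_le (kap * b) (n₀ - S)
      rw [show n₀ + kap * b - S = kap * b + (n₀ - S) by ring]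
      refine this.trans ?_
      have : |n₀ - S| = n₀ - S := abs_of_nonneg (by linarith)
      rw [this]; linarith
    calc |deriv μ n₀| * |n₀ + kap * b - S| ≤ M * (|kap * b| + 2 * Q / n₀) := by
          gcongr
          exact (abs_nonneg _).trans hM
      _ = M * (|kap * b| + 2 * ((kap * a) ^ 2 + (kap * b) ^ 2) / n₀) := by rw [hQ]
      _ ≤ 1 / 2 := hsmall
  have hp := (abs_le.1 hpert).1
  nlinarith

/-- The input reordering `(n₀, s, a, b) ↦ ((s, a, b), n₀)`, a diffeomorphism. [folklore] -/
def switchIn : (ℝ × ℝ × ℝ × ℝ) ≃ₘ⟮𝓘(ℝ, ℝ × ℝ × ℝ × ℝ), 𝓘(ℝ, (ℝ × ℝ × ℝ) × ℝ)⟯ ((ℝ × ℝ × ℝ) × ℝ) where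
  toFun q := (q.2, q.1)
  invFun r := (r.2, r.1)
  left_inv _ := rfl
  right_inv _ := rfl
  contMDiff_toFun := contMDiff_iff_contDiff.2 (contDiff_snd.prodMk contDiff_fst)
  contMDiff_invFun := contMDiff_iff_contDiff.2 (contDiff_snd.prodMk contDiff_fst)

/-- The value of `switchIn`. [folklore] -/
@[simp] theorem switchIn_apply (q : ℝ × ℝ × ℝ × ℝ) : switchIn q = (q.2, q.1) := rfl

/-- The output assembly `((s, a, b), X) ↦ ((X, κ a, -κ b), s)`, a diffeomorphism for `κ ≠ 0`. [folklore] -/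
def switchOut (hk : kap ≠ 0) : ((ℝ × ℝ × ℝ) × ℝ) ≃ₘ⟮𝓘(ℝ, (ℝ × ℝ × ℝ) × ℝ), 𝓘(ℝ, (𝔼 3) × ℝ)⟯ ((𝔼 3) × ℝ) where
  toFun r := (WithLp.toLp 2 ![r.2, kap * r.1.2.1, -(kap * r.1.2.2)], r.1.1)
  invFun q := ((q.2, q.1 1 / kap, -q.1 2 / kap), q.1 0)
  left_inv r := by
    obtain ⟨⟨s, a, b⟩, X⟩ := r
    simp only [Matrix.cons_val_one, Matrix.cons_val, Matrix.cons_val_zero, neg_neg,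
      mul_div_cancel_left₀ _ hk]
  right_inv q := by
    obtain ⟨v, s⟩ := q
    refine Prod.ext ?_ rfl
    ext j
    fin_cases j
    · simp
    · simp [mul_div_cancel₀ _ hk]
    · simp [mul_div_cancel₀ _ hk]
  contMDiff_toFun := by
    refine contMDiff_iff_contDiff.2 ?_
    refine ContDiff.prodMk ?_ (contDiff_fst.comp contDiff_fst)
    rw [contDiff_piLp]
    intro j
    fin_cases j
    · exact contDiff_snd
    · exact contDiff_const.mul (contDiff_fst.comp (contDiff_snd.comp contDiff_fst))
    · exact (contDiff_const.mul (contDiff_snd.comp (contDiff_snd.comp contDiff_fst))).neg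
  contMDiff_invFun := by
    refine contMDiff_iff_contDiff.2 ?_
    have hc : ∀ j : Fin 3, ContDiff ℝ ∞ fun q : (𝔼 3) × ℝ ↦ q.1 j := fun j ↦
      (contDiff_piLp_apply (p := 2) (i := j)).comp contDiff_fst
    exact (contDiff_snd.prodMk (((hc 1).div_const _).prodMk ((hc 2).neg.div_const _))).prodMk (hc 0)

/-- The switch factors: `switchXReal = switchOut ∘ (graph of switchX over (s, a, b)) ∘ switchIn`. [folklore] -/
theorem switchXReal_eq (hk : kap ≠ 0) (q : ℝ × ℝ × ℝ × ℝ) :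
    switchXReal μ kap q = switchOut hk ((switchIn q).1, switchX μ kap (switchIn q).2 (switchIn q).1.2.1 (switchIn q).1.2.2) := by
  simp only [switchXReal, switchOut, switchIn_apply]
  rfl

/-- Joint smoothness of the switch abscissa on the admissible region. [folklore] -/
theorem contDiffAt_switchX (hμ : ContDiff ℝ ∞ μ) {r : (ℝ × ℝ × ℝ) × ℝ}
    (h : (kap * r.1.2.1) ^ 2 + (kap * r.1.2.2) ^ 2 < r.2 ^ 2) :
    ContDiffAt ℝ ∞ (fun r : (ℝ × ℝ × ℝ) × ℝ ↦ switchX μ kap r.2 r.1.2.1 r.1.2.2) r := by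
  unfold switchX sphX
  have hμ' : ContDiffAt ℝ ∞ (fun r : (ℝ × ℝ × ℝ) × ℝ ↦ μ r.2) r := hμ.contDiffAt.comp r contDiffAt_snd
  have ha : ContDiffAt ℝ ∞ (fun r : (ℝ × ℝ × ℝ) × ℝ ↦ r.1.2.1) r :=
    (contDiff_fst.comp (contDiff_snd.comp contDiff_fst)).contDiffAt
  have hb : ContDiffAt ℝ ∞ (fun r : (ℝ × ℝ × ℝ) × ℝ ↦ r.1.2.2) r :=
    (contDiff_snd.comp (contDiff_snd.comp contDiff_fst)).contDiffAt
  have hsq : ContDiffAt ℝ ∞ (fun r : (ℝ × ℝ × ℝ) × ℝ ↦ Real.sqrt (r.2 ^ 2 - (kap * r.1.2.1) ^ 2 - (kap * r.1.2.2) ^ 2)) r := by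
    refine ContDiffAt.sqrt ?_ (show r.2 ^ 2 - (kap * r.1.2.1) ^ 2 - (kap * r.1.2.2) ^ 2 ≠ 0 by nlinarith [h])
    exact ((contDiffAt_snd.pow 2).sub ((contDiffAt_const.mul ha).pow 2)).sub ((contDiffAt_const.mul hb).pow 2)
  exact ((contDiffAt_const.sub hμ').mul hsq).add (hμ'.mul (contDiffAt_snd.add (contDiffAt_const.mul hb)))

/-- **The frame switch is a local diffeomorphism** (for `κ ≠ 0`) at points where the offsets are
strictly admissible and the `n₀`-derivative of the abscissa does not vanish (in particular under
the hypotheses of `half_le_deriv_switchX`). [folklore] -/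
theorem isLocalDiffeomorphAt_switchXReal (hμ : ContDiff ℝ ∞ μ) (hk : kap ≠ 0) {q : ℝ × ℝ × ℝ × ℝ}
    (h : (kap * q.2.2.1) ^ 2 + (kap * q.2.2.2) ^ 2 < q.1 ^ 2)
    (hder : -deriv μ q.1 * sphX q.1 (kap * q.2.2.1) (kap * q.2.2.2) +
        (1 - μ q.1) * (q.1 / Real.sqrt (q.1 ^ 2 - (kap * q.2.2.1) ^ 2 - (kap * q.2.2.2) ^ 2)) +
        (deriv μ q.1 * (q.1 + kap * q.2.2.2) + μ q.1 * 1) ≠ 0) :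
    IsLocalDiffeomorphAt 𝓘(ℝ, ℝ × ℝ × ℝ × ℝ) 𝓘(ℝ, (𝔼 3) × ℝ) ∞ (switchXReal μ kap) q := by
  have h1 : IsLocalDiffeomorphAt 𝓘(ℝ, ℝ × ℝ × ℝ × ℝ) 𝓘(ℝ, (ℝ × ℝ × ℝ) × ℝ) ∞ switchIn q := switchIn.isLocalDiffeomorph q
  have h2 : IsLocalDiffeomorphAt 𝓘(ℝ, (ℝ × ℝ × ℝ) × ℝ) 𝓘(ℝ, (ℝ × ℝ × ℝ) × ℝ) ∞
      (fun r : (ℝ × ℝ × ℝ) × ℝ ↦ (r.1, switchX μ kap r.2 r.1.2.1 r.1.2.2)) (switchIn q) := by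
    set U : Set ((ℝ × ℝ × ℝ) × ℝ) := {r | (kap * r.1.2.1) ^ 2 + (kap * r.1.2.2) ^ 2 < r.2 ^ 2} with hU
    have hUo : IsOpen U := by
      refine isOpen_lt ?_ (continuous_snd.pow 2)
      exact ((continuous_const.mul (continuous_fst.comp (continuous_snd.comp continuous_fst))).pow 2).add
        ((continuous_const.mul (continuous_snd.comp (continuous_snd.comp continuous_fst))).pow 2)
    have hmem : switchIn q ∈ U := by rw [hU]; exact h
    have hf : ContDiffOn ℝ ∞ (fun r : (ℝ × ℝ × ℝ) × ℝ ↦ switchX μ kap r.2 r.1.2.1 r.1.2.2) U :=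
      fun r hr ↦ (contDiffAt_switchX hμ hr).contDiffWithinAt
    have hd := hasDerivAt_switchX (μ := μ) (kap := kap) hμ (n₀ := q.1) (a := q.2.2.1) (b := q.2.2.2) h
    exact isLocalDiffeomorphAt_graph_real hUo hmem hf (by exact_mod_cast le_top) hder (by simpa using hd)
  have h3 := (switchOut hk (kap := kap)).isLocalDiffeomorph
    ((switchIn q).1, switchX μ kap (switchIn q).2 (switchIn q).1.2.1 (switchIn q).1.2.2)
  have hh := (h1.comp (K := 𝓘(ℝ, (ℝ × ℝ × ℝ) × ℝ)) (P := (ℝ × ℝ × ℝ) × ℝ) h2).comp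
    (K := 𝓘(ℝ, (𝔼 3) × ℝ)) (P := (𝔼 3) × ℝ) h3
  exact isLocalDiffeomorphAt_congr_nhds' hh (Eventually.of_forall fun q' ↦ switchXReal_eq hk q')

variable (ψ : ThreeTorus ≃ₘ⟮𝓣, 𝓣⟯ ThreeTorus)

/-- **The frame switch, read in the mapping torus, is a local diffeomorphism** (`0 < s < 3/2`). [folklore] -/
theorem isLocalDiffeomorphAt_mtCoord_switchXReal (hμ : ContDiff ℝ ∞ μ) (hk : kap ≠ 0) {q : ℝ × ℝ × ℝ × ℝ}
    (h : (kap * q.2.2.1) ^ 2 + (kap * q.2.2.2) ^ 2 < q.1 ^ 2)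
    (hder : -deriv μ q.1 * sphX q.1 (kap * q.2.2.1) (kap * q.2.2.2) +
        (1 - μ q.1) * (q.1 / Real.sqrt (q.1 ^ 2 - (kap * q.2.2.1) ^ 2 - (kap * q.2.2.2) ^ 2)) +
        (deriv μ q.1 * (q.1 + kap * q.2.2.2) + μ q.1 * 1) ≠ 0)
    (h0 : 0 < q.2.1) (h1 : q.2.1 < 3 / 2) :
    IsLocalDiffeomorphAt 𝓘(ℝ, ℝ × ℝ × ℝ × ℝ) 𝓘(ℝ, 𝔼 4) ∞ (fun q ↦ mtCoord ψ (switchXReal μ kap q)) q := by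
  have hR := isLocalDiffeomorphAt_switchXReal hμ hk h hder
  have hC : IsLocalDiffeomorphAt 𝓘(ℝ, (𝔼 3) × ℝ) 𝓘(ℝ, 𝔼 4) ∞ (mtCoord ψ) (switchXReal μ kap q) := by
    have h := isLocalDiffeomorphAt_mtCoord (ψ := ψ) (q := switchXReal μ kap q) h0 h1
    rw [← modelWithCornersSelf_prod, chartedSpaceSelf_prod] at h
    exact h
  exact hR.comp (K := 𝓘(ℝ, 𝔼 4)) (P := MTorus ψ) hC

/-- **Injectivity of the frame switch** (for `κ ≠ 0`) on a slab `n₀ ∈ [n₁, n₂]` on which, for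
the offsets in question, the abscissa is strictly increasing in `n₀`. [folklore] -/
theorem switchXReal_inj (hk : kap ≠ 0) {n₁ n₂ : ℝ} {q q' : ℝ × ℝ × ℝ × ℝ} (hq : q.1 ∈ Icc n₁ n₂) (hq' : q'.1 ∈ Icc n₁ n₂)
    (hmono : StrictMonoOn (fun n ↦ switchX μ kap n q.2.2.1 q.2.2.2) (Icc n₁ n₂))
    (heq : switchXReal μ kap q = switchXReal μ kap q') : q = q' := by
  have h0 := congrArg (fun r : (𝔼 3) × ℝ ↦ r.1 0) heq
  have h1 := congrArg (fun r : (𝔼 3) × ℝ ↦ r.1 1) heq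
  have h2 := congrArg (fun r : (𝔼 3) × ℝ ↦ r.1 2) heq
  have hs := congrArg Prod.snd heq
  simp only [switchXReal, PiLp.toLp_apply, Matrix.cons_val_one, Matrix.cons_val, Matrix.cons_val_zero] at h0 h1 h2 hs
  have ha : q.2.2.1 = q'.2.2.1 := mul_left_cancel₀ hk h1
  have hb : q.2.2.2 = q'.2.2.2 := mul_left_cancel₀ hk (neg_inj.1 h2)
  rw [← ha, ← hb] at h0
  have hn : q.1 = q'.1 := hmono.injOn hq hq' h0
  exact Prod.ext hn (Prod.ext hs (Prod.ext ha hb))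

/-- **Strict monotonicity of the abscissa on a slab** from a positive derivative. [folklore] -/
theorem strictMonoOn_switchX (hμ : ContDiff ℝ ∞ μ) {n₁ n₂ a b : ℝ} (hn₁ : 0 < n₁)
    (hadm : (kap * a) ^ 2 + (kap * b) ^ 2 < n₁ ^ 2)
    (hpos : ∀ n ∈ Icc n₁ n₂, 0 < -deriv μ n * sphX n (kap * a) (kap * b) +
        (1 - μ n) * (n / Real.sqrt (n ^ 2 - (kap * a) ^ 2 - (kap * b) ^ 2)) +
        (deriv μ n * (n + kap * b) + μ n * 1)) :
    StrictMonoOn (fun n ↦ switchX μ kap n a b) (Icc n₁ n₂) := by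
  have hadm' : ∀ n ∈ Icc n₁ n₂, (kap * a) ^ 2 + (kap * b) ^ 2 < n ^ 2 := fun n hn ↦ by
    have : n₁ ^ 2 ≤ n ^ 2 := pow_le_pow_left₀ hn₁.le hn.1 2
    linarith
  refine strictMonoOn_of_deriv_pos (convex_Icc n₁ n₂) ?_ fun n hn ↦ ?_
  · exact fun n hn ↦ (hasDerivAt_switchX hμ (hadm' n hn)).continuousAt.continuousWithinAt
  · rw [interior_Icc] at hn
    have hn' : n ∈ Icc n₁ n₂ := Ioo_subset_Icc_self hn
    rw [(hasDerivAt_switchX hμ (hadm' n hn')).deriv]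
    exact hpos n hn'

end Switch

/-! ### The mirrored pieces at the north cap

Near the centre of the *north* cap the base surface is the axis `{(e^{in}, 1, 1)}`, `n < 0`, i.e.
the sphere form is `n₀ (-√(1 - κ²(a²+b²)), κ a, -κ b)` and the vertical tube is
`(-n₀ + κ b, κ a, -κ b)`. Both are obtained from the south pieces by the linear involution
`L (x, y, z) = (-x, y, -z)` after `b ↦ -b`. -/

section North

/-- The linear involution `((x, y, z), s) ↦ ((-x, y, -z), s)` of the exponential coordinates. [folklore] -/
def mirrorL : ((𝔼 3) × ℝ) ≃ₘ⟮𝓘(ℝ, (𝔼 3) × ℝ), 𝓘(ℝ, (𝔼 3) × ℝ)⟯ ((𝔼 3) × ℝ) where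
  toFun q := (WithLp.toLp 2 ![-q.1 0, q.1 1, -q.1 2], q.2)
  invFun q := (WithLp.toLp 2 ![-q.1 0, q.1 1, -q.1 2], q.2)
  left_inv q := by
    obtain ⟨v, s⟩ := q
    refine Prod.ext ?_ rfl
    ext j; fin_cases j <;> simp
  right_inv q := by
    obtain ⟨v, s⟩ := q
    refine Prod.ext ?_ rfl
    ext j; fin_cases j <;> simp
  contMDiff_toFun := by
    refine contMDiff_iff_contDiff.2 (ContDiff.prodMk ?_ contDiff_snd)
    have hc : ∀ j : Fin 3, ContDiff ℝ ∞ fun q : (𝔼 3) × ℝ ↦ q.1 j := fun j ↦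
      (contDiff_piLp_apply (p := 2) (i := j)).comp contDiff_fst
    rw [contDiff_piLp]
    intro j; fin_cases j
    · exact (hc 0).neg
    · exact hc 1
    · exact (hc 2).neg
  contMDiff_invFun := by
    refine contMDiff_iff_contDiff.2 (ContDiff.prodMk ?_ contDiff_snd)
    have hc : ∀ j : Fin 3, ContDiff ℝ ∞ fun q : (𝔼 3) × ℝ ↦ q.1 j := fun j ↦
      (contDiff_piLp_apply (p := 2) (i := j)).comp contDiff_fst
    rw [contDiff_piLp]
    intro j; fin_cases j
    · exact (hc 0).neg
    · exact hc 1
    · exact (hc 2).neg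

/-- The value of `mirrorL`. [folklore] -/
@[simp] theorem mirrorL_apply (q : (𝔼 3) × ℝ) : mirrorL q = (WithLp.toLp 2 ![-q.1 0, q.1 1, -q.1 2], q.2) := rfl

/-- `mirrorL` is injective. [folklore] -/
theorem mirrorL_injective : Injective mirrorL := mirrorL.injective

/-- The source involution `(n₀, s, a, b) ↦ (n₀, s, a, -b)`. [folklore] -/
def negB : (ℝ × ℝ × ℝ × ℝ) ≃ₘ⟮𝓘(ℝ, ℝ × ℝ × ℝ × ℝ), 𝓘(ℝ, ℝ × ℝ × ℝ × ℝ)⟯ (ℝ × ℝ × ℝ × ℝ) where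
  toFun q := (q.1, q.2.1, q.2.2.1, -q.2.2.2)
  invFun q := (q.1, q.2.1, q.2.2.1, -q.2.2.2)
  left_inv q := by simp
  right_inv q := by simp
  contMDiff_toFun := contMDiff_iff_contDiff.2 <| contDiff_fst.prodMk ((contDiff_fst.comp contDiff_snd).prodMk
    ((contDiff_fst.comp (contDiff_snd.comp contDiff_snd)).prodMk (contDiff_snd.comp (contDiff_snd.comp contDiff_snd)).neg))
  contMDiff_invFun := contMDiff_iff_contDiff.2 <| contDiff_fst.prodMk ((contDiff_fst.comp contDiff_snd).prodMk
    ((contDiff_fst.comp (contDiff_snd.comp contDiff_snd)).prodMk (contDiff_snd.comp (contDiff_snd.comp contDiff_snd)).neg))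

/-- The value of `negB`. [folklore] -/
@[simp] theorem negB_apply (q : ℝ × ℝ × ℝ × ℝ) : negB q = (q.1, q.2.1, q.2.2.1, -q.2.2.2) := rfl

variable (kap' : ℝ → ℝ) (μ : ℝ → ℝ) (kap : ℝ)

/-- **The rescaling at the north cap**: `(n₀, s, a, b) ↦ ((-√(n₀² - κ²(a²+b²)), κ a, -κ b), s)`. [folklore] -/
def scaleRealN (q : ℝ × ℝ × ℝ × ℝ) : (𝔼 3) × ℝ := mirrorL (scaleReal kap' (negB q))

/-- **The frame switch at the north cap**: `x = -((1 - μ) √(n₀² - κ²(a²+b²)) + μ (n₀ - κ b))`,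
`(y, z) = (κ a, -κ b)`. [folklore] -/
def switchXRealN (q : ℝ × ℝ × ℝ × ℝ) : (𝔼 3) × ℝ := mirrorL (switchXReal μ kap (negB q))

variable {kap' μ kap}

/-- The value of the north rescaling. [folklore] -/
theorem scaleRealN_apply (q : ℝ × ℝ × ℝ × ℝ) : scaleRealN kap' q =
    (WithLp.toLp 2 ![-sphX q.1 (kap' q.1 * q.2.2.1) (kap' q.1 * -q.2.2.2), kap' q.1 * q.2.2.1, -(kap' q.1 * q.2.2.2)], q.2.1) := by
  simp [scaleRealN, scaleReal]

/-- The value of the north switch at `μ = 1`: the vertical tube `(-n₀ + κ b, κ a, -κ b)`. [folklore] -/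
theorem switchXRealN_of_mu_one {q : ℝ × ℝ × ℝ × ℝ} (h : μ q.1 = 1) :
    switchXRealN μ kap q = (WithLp.toLp 2 ![-q.1 + kap * q.2.2.2, kap * q.2.2.1, -(kap * q.2.2.2)], q.2.1) := by
  have h' : μ (negB q).1 = 1 := h
  rw [switchXRealN, switchXReal_of_mu_one h']
  simp only [mirrorL_apply, negB_apply]
  refine Prod.ext ?_ rfl
  ext j; fin_cases j <;> simp; ring

/-- At `μ = 0` the north switch is the north rescaling with constant scale. [folklore] -/
theorem switchXRealN_of_mu_zero {q : ℝ × ℝ × ℝ × ℝ} (h : μ q.1 = 0) :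
    switchXRealN μ kap q = scaleRealN (fun _ ↦ kap) q := by
  have h' : μ (negB q).1 = 0 := h
  rw [switchXRealN, switchXReal_of_mu_zero h', scaleRealN]

/-- **The sphere radius is preserved by the north rescaling.** [folklore] -/
theorem norm_scaleRealN {q : ℝ × ℝ × ℝ × ℝ} (hn : 0 ≤ q.1)
    (h : (kap' q.1 * q.2.2.1) ^ 2 + (kap' q.1 * q.2.2.2) ^ 2 ≤ q.1 ^ 2) : ‖(scaleRealN kap' q).1‖ = q.1 := by
  have h' : (kap' (negB q).1 * (negB q).2.2.1) ^ 2 + (kap' (negB q).1 * (negB q).2.2.2) ^ 2 ≤ (negB q).1 ^ 2 := by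
    simpa using h
  have hs := norm_scaleReal (kap := kap') (q := negB q) hn h'
  rw [scaleRealN, mirrorL_apply]
  rw [EuclideanSpace.norm_eq] at hs ⊢
  simp only [Fin.sum_univ_three, Matrix.cons_val_zero, Matrix.cons_val_one, Matrix.cons_val, Real.norm_eq_abs,
    sq_abs, neg_sq] at hs ⊢
  exact hs

/-- **Injectivity of the north rescaling.** [folklore] -/
theorem scaleRealN_inj {q q' : ℝ × ℝ × ℝ × ℝ} (hn : 0 < q.1) (hn' : 0 < q'.1) (hk : ∀ n, 0 < n → kap' n ≠ 0)
    (h : (kap' q.1 * q.2.2.1) ^ 2 + (kap' q.1 * q.2.2.2) ^ 2 ≤ q.1 ^ 2)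
    (h' : (kap' q'.1 * q'.2.2.1) ^ 2 + (kap' q'.1 * q'.2.2.2) ^ 2 ≤ q'.1 ^ 2)
    (heq : scaleRealN kap' q = scaleRealN kap' q') : q = q' := by
  have h1 := mirrorL_injective heq
  have h2 := scaleReal_inj (kap := kap') (q := negB q) (q' := negB q') hn hn' hk (by simpa using h) (by simpa using h') h1
  exact negB.injective h2

/-- **Injectivity of the north switch** on a slab where the (south) abscissa is strictly monotone. [folklore] -/
theorem switchXRealN_inj (hk : kap ≠ 0) {n₁ n₂ : ℝ} {q q' : ℝ × ℝ × ℝ × ℝ} (hq : q.1 ∈ Icc n₁ n₂) (hq' : q'.1 ∈ Icc n₁ n₂)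
    (hmono : StrictMonoOn (fun n ↦ switchX μ kap n q.2.2.1 (-q.2.2.2)) (Icc n₁ n₂))
    (heq : switchXRealN μ kap q = switchXRealN μ kap q') : q = q' := by
  have h1 := mirrorL_injective heq
  have h2 := switchXReal_inj (μ := μ) hk (q := negB q) (q' := negB q') hq hq' hmono h1
  exact negB.injective h2

/-- **The north rescaling is a local diffeomorphism** (same hypotheses as the south one). [folklore] -/
theorem isLocalDiffeomorphAt_scaleRealN (hkap : ContDiff ℝ ∞ kap') {q : ℝ × ℝ × ℝ × ℝ} (hn : 0 < q.1)
    (hk : kap' q.1 ≠ 0) (h : (kap' q.1 * q.2.2.1) ^ 2 + (kap' q.1 * q.2.2.2) ^ 2 < q.1 ^ 2) :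
    IsLocalDiffeomorphAt 𝓘(ℝ, ℝ × ℝ × ℝ × ℝ) 𝓘(ℝ, (𝔼 3) × ℝ) ∞ (scaleRealN kap') q := by
  have h1 : IsLocalDiffeomorphAt 𝓘(ℝ, ℝ × ℝ × ℝ × ℝ) 𝓘(ℝ, ℝ × ℝ × ℝ × ℝ) ∞ negB q := negB.isLocalDiffeomorph q
  have h2 := isLocalDiffeomorphAt_scaleReal (kap := kap') (q := negB q) hkap hn hk (by simpa using h)
  have h3 := mirrorL.isLocalDiffeomorph (scaleReal kap' (negB q))
  exact (h1.comp (K := 𝓘(ℝ, (𝔼 3) × ℝ)) (P := (𝔼 3) × ℝ) h2).comp (K := 𝓘(ℝ, (𝔼 3) × ℝ)) (P := (𝔼 3) × ℝ) h3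

/-- **The north switch is a local diffeomorphism** (same hypotheses as the south one, at `(n₀, s, a, -b)`). [folklore] -/
theorem isLocalDiffeomorphAt_switchXRealN (hμ : ContDiff ℝ ∞ μ) (hk : kap ≠ 0) {q : ℝ × ℝ × ℝ × ℝ}
    (h : (kap * q.2.2.1) ^ 2 + (kap * q.2.2.2) ^ 2 < q.1 ^ 2)
    (hder : -deriv μ q.1 * sphX q.1 (kap * q.2.2.1) (kap * -q.2.2.2) +
        (1 - μ q.1) * (q.1 / Real.sqrt (q.1 ^ 2 - (kap * q.2.2.1) ^ 2 - (kap * -q.2.2.2) ^ 2)) +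
        (deriv μ q.1 * (q.1 + kap * -q.2.2.2) + μ q.1 * 1) ≠ 0) :
    IsLocalDiffeomorphAt 𝓘(ℝ, ℝ × ℝ × ℝ × ℝ) 𝓘(ℝ, (𝔼 3) × ℝ) ∞ (switchXRealN μ kap) q := by
  have h1 : IsLocalDiffeomorphAt 𝓘(ℝ, ℝ × ℝ × ℝ × ℝ) 𝓘(ℝ, ℝ × ℝ × ℝ × ℝ) ∞ negB q := negB.isLocalDiffeomorph q
  have h2 := isLocalDiffeomorphAt_switchXReal (μ := μ) (kap := kap) (q := negB q) hμ hk (by simpa using h) hder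
  have h3 := mirrorL.isLocalDiffeomorph (switchXReal μ kap (negB q))
  exact (h1.comp (K := 𝓘(ℝ, (𝔼 3) × ℝ)) (P := (𝔼 3) × ℝ) h2).comp (K := 𝓘(ℝ, (𝔼 3) × ℝ)) (P := (𝔼 3) × ℝ) h3

variable (ψ : ThreeTorus ≃ₘ⟮𝓣, 𝓣⟯ ThreeTorus)

/-- The north rescaling read in the mapping torus is a local diffeomorphism (`0 < s < 3/2`). [folklore] -/
theorem isLocalDiffeomorphAt_mtCoord_scaleRealN (hkap : ContDiff ℝ ∞ kap') {q : ℝ × ℝ × ℝ × ℝ} (hn : 0 < q.1)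
    (hk : kap' q.1 ≠ 0) (h : (kap' q.1 * q.2.2.1) ^ 2 + (kap' q.1 * q.2.2.2) ^ 2 < q.1 ^ 2)
    (h0 : 0 < q.2.1) (h1 : q.2.1 < 3 / 2) :
    IsLocalDiffeomorphAt 𝓘(ℝ, ℝ × ℝ × ℝ × ℝ) 𝓘(ℝ, 𝔼 4) ∞ (fun q ↦ mtCoord ψ (scaleRealN kap' q)) q := by
  have hR := isLocalDiffeomorphAt_scaleRealN hkap hn hk h
  have hC : IsLocalDiffeomorphAt 𝓘(ℝ, (𝔼 3) × ℝ) 𝓘(ℝ, 𝔼 4) ∞ (mtCoord ψ) (scaleRealN kap' q) := by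
    have h := isLocalDiffeomorphAt_mtCoord (ψ := ψ) (q := scaleRealN kap' q) h0 h1
    rw [← modelWithCornersSelf_prod, chartedSpaceSelf_prod] at h
    exact h
  exact hR.comp (K := 𝓘(ℝ, 𝔼 4)) (P := MTorus ψ) hC

/-- The north switch read in the mapping torus is a local diffeomorphism (`0 < s < 3/2`). [folklore] -/
theorem isLocalDiffeomorphAt_mtCoord_switchXRealN (hμ : ContDiff ℝ ∞ μ) (hk : kap ≠ 0) {q : ℝ × ℝ × ℝ × ℝ}
    (h : (kap * q.2.2.1) ^ 2 + (kap * q.2.2.2) ^ 2 < q.1 ^ 2)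
    (hder : -deriv μ q.1 * sphX q.1 (kap * q.2.2.1) (kap * -q.2.2.2) +
        (1 - μ q.1) * (q.1 / Real.sqrt (q.1 ^ 2 - (kap * q.2.2.1) ^ 2 - (kap * -q.2.2.2) ^ 2)) +
        (deriv μ q.1 * (q.1 + kap * -q.2.2.2) + μ q.1 * 1) ≠ 0)
    (h0 : 0 < q.2.1) (h1 : q.2.1 < 3 / 2) :
    IsLocalDiffeomorphAt 𝓘(ℝ, ℝ × ℝ × ℝ × ℝ) 𝓘(ℝ, 𝔼 4) ∞ (fun q ↦ mtCoord ψ (switchXRealN μ kap q)) q := by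
  have hR := isLocalDiffeomorphAt_switchXRealN hμ hk h hder
  have hC : IsLocalDiffeomorphAt 𝓘(ℝ, (𝔼 3) × ℝ) 𝓘(ℝ, 𝔼 4) ∞ (mtCoord ψ) (switchXRealN μ kap q) := by
    have h := isLocalDiffeomorphAt_mtCoord (ψ := ψ) (q := switchXRealN μ kap q) h0 h1
    rw [← modelWithCornersSelf_prod, chartedSpaceSelf_prod] at h
    exact h
  exact hR.comp (K := 𝓘(ℝ, 𝔼 4)) (P := MTorus ψ) hC

end North

end Literature.Topology.FourManifolds
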